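import Mathlib
import Summits.ValiantsHypothesis.ValiantsHypothesis.Theorems.RigidityForcesSymmetryRankRigidMinimalReprLaplaceFiveSeparatedCaptureEqualSpans
import Summits.ValiantsHypothesis.ValiantsHypothesis.Theorems.RigidityForcesSymmetryRankRigidMinimalReprLaplaceFiveSeparatedCaptureTwoCuts
import Summits.ValiantsHypothesis.ValiantsHypothesis.Theorems.RigidityForcesSymmetryRankRigidMinimalReprLaplaceFiveSeparatedCaptureAgreement
import Summits.ValiantsHypothesis.ValiantsHypothesis.Theorems.RigidityForcesSymmetryRankRigidMinimalReprLaplaceFiveSeparatedCaptureProlongation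

/-!
# ValiantsHypothesis / RigidityForcesSymmetry — crux `LaplaceOptimalFive` (stmt-ValiantsHypothesis-24813), symmetric capture (SC):
# ★★ **THE JOINT-PROLONGATION RESIDUE: every captured symmetric tensor is an EQUAL-SPANS tensor modulo `prolong (U₀₁ ⊔ U₀₂ ⊔ U₁₂)`**,
# hence `finrank W ≤ 3·finrank U_i + finrank (prolong (U₀₁ ⊔ U₀₂ ⊔ U₁₂))` for EACH slot `i`, and ★★ `(SC)` WHENEVER THE JOINT SPAN HAS NO PROLONGATION

Write a captured obligation in finite form `T(p,q,r) = A_r(p,q) + B_q(p,r) + C_p(q,r)` (✓ `L3_finite_form`, `A_a ∈ U₀₁`, `B_a ∈ U₀₂`,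
`C_a ∈ U₁₂`).  The slot symmetries of `T` make the agreement tuples `A − B`, `B − C` fully symmetric (✓ `agreement23`, ✓ `agreement12`), and
three lines of algebra give the RESIDUE IDENTITIES (`residueA/B/C`):

  `T(p,q,a) − (C_a(p,q) + C_q(p,a) + C_p(q,a)) = (A_a + B_a − 2·C_a)(p,q)`   (and cyclically for `A`, `B`).

So `T − 3·Sym(C)` — with `3·Sym(C)(p,q,r) = C_r(p,q) + C_q(p,r) + C_p(q,r)`, an element of the EQUAL-spans configuration space
`L3 U₁₂ U₁₂ U₁₂` (`symPlaced_mem_L3`) — is a fully symmetric tensor ALL of whose slices lie in the joint span `X = U₀₁ ⊔ U₀₂ ⊔ U₁₂`, i.e. an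
element of ✓ `prolong X` (`sub_symPlaced_mem_prolong`).  Consequences (no hypothesis on the dimensions or on the position of the three spans):

* ★★ `finrank_le_three_mul_add_prolong_12 / _02 / _01` — `finrank W ≤ 3·finrank U_i + finrank (prolong (U₀₁ ⊔ U₀₂ ⊔ U₁₂))` for each of the
  three slots (rank–nullity for `μ ↦ P₅ ⌞ μ mod L3 U_i U_i U_i` on `W`: the kernel is an equal-spans captured space, bounded by
  ✓ `finrank_le_three_mul_of_equalSpans`; the image lies in the image of the joint prolongation);
* ★★ `captureIneqSym_of_prolong_eq_bot` — if `prolong (U₀₁ ⊔ U₀₂ ⊔ U₁₂) = ⊥` then `finrank W ≤ finrank U₀₁ + finrank U₀₂ + finrank U₁₂`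
  (sum of the three slot bounds: `3·finrank W ≤ 3·Σ finrank U_i`).  This is `CaptureIneqSym` on the whole locus «joint span without
  prolongation» — every profile, every position (e.g. all configurations whose joint span is a generic space of dimension `≤ 7`, all
  pair-monomial configurations whose union graph is triangle-free, the Laplace atoms `⟨x₀x₁⟩³`, `⟨x₀x₁, x₂x₃⟩³` with equality);
* `captureIneqSym_of_prolong_le` — the bookkeeping form `finrank (prolong X) + 3·min ≤ Σ finrank U_i ⇒ (SC)`, to be fed with the tree's
  prolongation bounds (✓ `finrank_prolong_le_one/two/four/five`).

Located numerically before typing (seat engine `work/py/sc.py`, exact mod p): `W ⊆ SF ∩ ⋂_i (U_i·V + prolong X)` with `dim ≤ Σ dim U_i` in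
1 079 / 1 079 structured configurations (the intersection is often strictly larger than `W`).

Honest framing.  Structural lemmas + one new closed region of an OPEN inequality: `CaptureIneqSym` in general, K1 on `K₃ ⊔ K₂`, S2′,
`LaplaceOptimalFive` (stmt-24813, OPEN · CONTESTED 72/120), `RankRigidMinimalRepr`, `VP ≠ VNP` are NOT proved.  No definitions, no `sorry`;
Mathlib + tree only.
-/

set_option linter.dupNamespace false
set_option autoImplicit false

namespace Summit.ValiantsHypothesis.ValiantsHypothesis.Theorems.RigidityForcesSymmetryRankRigidMinimalRepr

namespace LaplaceFiveSeparatedCapture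

open Finset

/-! ### The symmetrised placement of one tuple lies in the equal-spans configuration space -/

/-- A tuple `C : Fin 5 → U` placed on the slots `(1,2 | 0)` lies in `L₃(V, V', U)` (any first/second spans). [folklore] -/
theorem placed12_mem_L3 (V V' U : Submodule ℂ (Fin 5 → Fin 5 → ℂ)) (C : Fin 5 → Fin 5 → Fin 5 → ℂ) (hC : ∀ p, C p ∈ U) :
    (fun p q r => C p q r) ∈ L3 V V' U := by
  classical
  have h : (fun p q r => C p q r) = ∑ p₀ : Fin 5, fun p q r => C p₀ q r * (if p = p₀ then (1 : ℂ) else 0) := by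
    funext p q r
    simp only [Finset.sum_apply, mul_ite, mul_one, mul_zero, Finset.sum_ite_eq, Finset.mem_univ, if_true]
  rw [h]
  refine Submodule.sum_mem _ fun p₀ _ => Submodule.subset_span (Or.inr ⟨C p₀, hC p₀, _, rfl⟩)

/-- The SYMMETRISED PLACEMENT `(p,q,r) ↦ C_r(p,q) + C_q(p,r) + C_p(q,r)` of a tuple `C : Fin 5 → U` (= `3·Sym(C)`) lies in the
EQUAL-spans configuration space `L₃(U, U, U)`. [folklore] -/
theorem symPlaced_mem_L3 (U : Submodule ℂ (Fin 5 → Fin 5 → ℂ)) (C : Fin 5 → Fin 5 → Fin 5 → ℂ) (hC : ∀ a, C a ∈ U) :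
    (fun p q r => C r p q + C q p r + C p q r) ∈ L3 U U U := by
  have h1 := placed01_mem_L3 U U U C hC
  have h2 := placed02_mem_L3 U U U C hC
  have h3 := placed12_mem_L3 U U U C hC
  have e : (fun p q r => C r p q + C q p r + C p q r)
      = (fun p q r => C r p q) + (fun p q r => C q p r) + (fun p q r => C p q r) := by
    funext p q r; simp only [Pi.add_apply]
  rw [e]
  exact Submodule.add_mem _ (Submodule.add_mem _ h1 h2) h3

/-! ### The residue identities -/

/-- RESIDUE IDENTITY for the `C`-tuple: `T(p,q,a) − 3·Sym(C)(p,q,a) = (A_a + B_a − 2·C_a)(p,q)`. [folklore] -/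
theorem residueC (A B C T : Fin 5 → Fin 5 → Fin 5 → ℂ)
    (hA : ∀ r p q, A r p q = A r q p) (hB : ∀ r p q, B r p q = B r q p) (hC : ∀ r p q, C r p q = C r q p)
    (hT : ∀ p q r, T p q r = A r p q + B q p r + C p q r)
    (h12 : ∀ p q r, T q p r = T p q r) (p q a : Fin 5) :
    T p q a - (C a p q + C q p a + C p q a) = A a p q + B a p q - 2 * C a p q := by
  have e0 := hT p q a
  have e1 := agreement12 A B C T hA hT h12 p q a
  have e2 := agreement12 A B C T hA hT h12 a p q
  have e3 := hB p q a
  have e4 := hC p q a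
  linear_combination e0 + e1 + e2 + e3 - e4

/-- RESIDUE IDENTITY for the `B`-tuple: `T(p,q,a) − 3·Sym(B)(p,q,a) = (A_a − 2·B_a + C_a)(p,q)`. [folklore] -/
theorem residueB (A B C T : Fin 5 → Fin 5 → Fin 5 → ℂ)
    (hA : ∀ r p q, A r p q = A r q p) (hB : ∀ r p q, B r p q = B r q p) (hC : ∀ r p q, C r p q = C r q p)
    (hT : ∀ p q r, T p q r = A r p q + B q p r + C p q r)
    (h12 : ∀ p q r, T q p r = T p q r) (p q a : Fin 5) :
    T p q a - (B a p q + B q p a + B p q a) = A a p q - 2 * B a p q + C a p q := by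
  have e0 := hT p q a
  have e2 := agreement12 A B C T hA hT h12 a p q
  have e3 := hB p q a
  have e4 := hC p q a
  linear_combination e0 - e2 - e3 + e4

/-- RESIDUE IDENTITY for the `A`-tuple: `T(p,q,a) − 3·Sym(A)(p,q,a) = (−2·A_a + B_a + C_a)(p,q)`. [folklore] -/
theorem residueA (A B C T : Fin 5 → Fin 5 → Fin 5 → ℂ)
    (hA : ∀ r p q, A r p q = A r q p) (hB : ∀ r p q, B r p q = B r q p) (hC : ∀ r p q, C r p q = C r q p)
    (hT : ∀ p q r, T p q r = A r p q + B q p r + C p q r)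
    (h12 : ∀ p q r, T q p r = T p q r) (h23 : ∀ p q r, T p r q = T p q r) (p q a : Fin 5) :
    T p q a - (A a p q + A q p a + A p q a) = -2 * A a p q + B a p q + C a p q := by
  have e0 := hT p q a
  have f1 := agreement23 A B C T hC hT h23 p a q
  have f2 := agreement23 A B C T hC hT h23 a q p
  have e2 := agreement12 A B C T hA hT h12 a p q
  have s1 := hA p q a
  have s2 := hA q p a
  have s3 := hB q p a
  have s4 := hC p q a
  linear_combination e0 - 2 * f1 - f2 - e2 - s1 + s2 - s3 + s4

/-! ### The residue lies in the joint prolongation -/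

/-- ★ **JOINT-PROLONGATION RESIDUE.**  For a tensor `T` with both slot symmetries, captured in finite form by symmetric tuples
`A_a ∈ U₀₁`, `B_a ∈ U₀₂`, `C_a ∈ U₁₂`, the difference `T − 3·Sym(C)` lies in `prolong (U₀₁ ⊔ U₀₂ ⊔ U₁₂)`; likewise for `A` and `B`. [folklore] -/
theorem sub_symPlaced_mem_prolong (U01 U02 U12 : Submodule ℂ (Fin 5 → Fin 5 → ℂ))
    (A B C T : Fin 5 → Fin 5 → Fin 5 → ℂ) (hAm : ∀ a, A a ∈ U01) (hBm : ∀ a, B a ∈ U02) (hCm : ∀ a, C a ∈ U12)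
    (hA : ∀ r p q, A r p q = A r q p) (hB : ∀ r p q, B r p q = B r q p) (hC : ∀ r p q, C r p q = C r q p)
    (hT : ∀ p q r, T p q r = A r p q + B q p r + C p q r)
    (h12 : ∀ p q r, T q p r = T p q r) (h23 : ∀ p q r, T p r q = T p q r) :
    (T - fun p q r => C r p q + C q p r + C p q r) ∈ prolong (U01 ⊔ U02 ⊔ U12) ∧
    (T - fun p q r => B r p q + B q p r + B p q r) ∈ prolong (U01 ⊔ U02 ⊔ U12) ∧
    (T - fun p q r => A r p q + A q p r + A p q r) ∈ prolong (U01 ⊔ U02 ⊔ U12) := by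
  refine ⟨(mem_prolong_iff _ _).mpr ⟨?_, ?_, fun a => ?_⟩, (mem_prolong_iff _ _).mpr ⟨?_, ?_, fun a => ?_⟩,
    (mem_prolong_iff _ _).mpr ⟨?_, ?_, fun a => ?_⟩⟩
  · intro p q r
    simp only [Pi.sub_apply]
    rw [h12 p q r, hC r q p]; ring
  · intro p q r
    simp only [Pi.sub_apply]
    rw [h23 p q r, hC p r q]; ring
  · -- slice `a`: `(A_a + B_a − 2 C_a)`
    have e : (T - fun p q r => C r p q + C q p r + C p q r) a = A a + B a - (2 : ℂ) • C a := by
      funext p q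
      simp only [Pi.sub_apply, Pi.add_apply, Pi.smul_apply, smul_eq_mul]
      have h := residueC A B C T hA hB hC hT h12 p q a
      rw [h12 p a q, h23 p q a]
      linear_combination h - hC q a p - hC p a q
    rw [e]
    exact Submodule.sub_mem _ (Submodule.add_mem _ (Submodule.mem_sup_left (Submodule.mem_sup_left (hAm a)))
      (Submodule.mem_sup_left (Submodule.mem_sup_right (hBm a)))) (Submodule.smul_mem _ _ (Submodule.mem_sup_right (hCm a)))
  · intro p q r
    simp only [Pi.sub_apply]
    rw [h12 p q r, hB r q p]; ring
  · intro p q r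
    simp only [Pi.sub_apply]
    rw [h23 p q r, hB p r q]; ring
  · have e : (T - fun p q r => B r p q + B q p r + B p q r) a = A a - (2 : ℂ) • B a + C a := by
      funext p q
      simp only [Pi.sub_apply, Pi.add_apply, Pi.smul_apply, smul_eq_mul]
      have h := residueB A B C T hA hB hC hT h12 p q a
      rw [h12 p a q, h23 p q a]
      linear_combination h - hB q a p - hB p a q
    rw [e]
    exact Submodule.add_mem _ (Submodule.sub_mem _ (Submodule.mem_sup_left (Submodule.mem_sup_left (hAm a)))
      (Submodule.smul_mem _ _ (Submodule.mem_sup_left (Submodule.mem_sup_right (hBm a))))) (Submodule.mem_sup_right (hCm a))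
  · intro p q r
    simp only [Pi.sub_apply]
    rw [h12 p q r, hA r q p]; ring
  · intro p q r
    simp only [Pi.sub_apply]
    rw [h23 p q r, hA p r q]; ring
  · have e : (T - fun p q r => A r p q + A q p r + A p q r) a = -((2 : ℂ) • A a) + B a + C a := by
      funext p q
      simp only [Pi.sub_apply, Pi.add_apply, Pi.neg_apply, Pi.smul_apply, smul_eq_mul]
      have h := residueA A B C T hA hB hC hT h12 h23 p q a
      rw [h12 p a q, h23 p q a]
      linear_combination h - hA q a p - hA p a q
    rw [e]
    exact Submodule.add_mem _ (Submodule.add_mem _ (Submodule.neg_mem _ (Submodule.smul_mem _ _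
      (Submodule.mem_sup_left (Submodule.mem_sup_left (hAm a))))) (Submodule.mem_sup_left (Submodule.mem_sup_right (hBm a))))
      (Submodule.mem_sup_right (hCm a))

/-! ### Counting: rank–nullity modulo an equal-spans configuration space -/

/-- COUNTING LEMMA.  If every obligation of `W` is congruent, modulo a subspace `L'`, to an element of a subspace `PX`, and every
captured subspace `W' ≤ W` whose obligations lie IN `L'` has `finrank ≤ b`, then `finrank W ≤ b + finrank PX`
(rank–nullity for `μ ↦ (P₅ ⌞ μ) mod L'` on `W`; injectivity of `μ ↦ P₅ ⌞ μ` is not even needed). [folklore] -/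
theorem finrank_le_of_split_mod (W : Submodule ℂ (Fin 5 → Fin 5 → ℂ)) (L' PX : Submodule ℂ (Fin 5 → Fin 5 → Fin 5 → ℂ)) (b : ℕ)
    (hsplit : ∀ μ ∈ W, ∃ G ∈ PX, contractZ μ - G ∈ L')
    (hker : ∀ W' : Submodule ℂ (Fin 5 → Fin 5 → ℂ), W' ≤ W → (∀ μ ∈ W', contractZ μ ∈ L') → Module.finrank ℂ W' ≤ b) :
    Module.finrank ℂ W ≤ b + Module.finrank ℂ PX := by
  let ψ : W →ₗ[ℂ] ((Fin 5 → Fin 5 → Fin 5 → ℂ) ⧸ L') := (L'.mkQ ∘ₗ cZ).domRestrict W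
  have hψ : ∀ μ : W, ψ μ = L'.mkQ (contractZ μ.1) := fun μ => by
    simp [ψ, LinearMap.domRestrict_apply, cZ_apply]
  -- the image lies in the image of `PX`
  have hrange : LinearMap.range ψ ≤ PX.map L'.mkQ := by
    rintro _ ⟨μ, rfl⟩
    obtain ⟨G, hG, hL⟩ := hsplit μ.1 μ.2
    refine Submodule.mem_map.mpr ⟨G, hG, ?_⟩
    rw [hψ]
    have h0 : L'.mkQ (contractZ μ.1 - G) = 0 := by
      rw [Submodule.mkQ_apply, Submodule.Quotient.mk_eq_zero]
      exact hL
    rw [map_sub, sub_eq_zero] at h0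
    exact h0.symm
  have h1 : Module.finrank ℂ (LinearMap.range ψ) ≤ Module.finrank ℂ PX :=
    (Submodule.finrank_mono hrange).trans (Submodule.finrank_map_le _ _)
  -- the kernel is a captured subspace with obligations in `L'`
  have hker' : Module.finrank ℂ (LinearMap.ker ψ) ≤ b := by
    rw [← Submodule.finrank_map_subtype_eq W (LinearMap.ker ψ)]
    refine hker _ (fun x hx => ?_) (fun μ hμ => ?_)
    · obtain ⟨y, -, rfl⟩ := Submodule.mem_map.mp hx
      exact y.2
    · obtain ⟨y, hy, rfl⟩ := Submodule.mem_map.mp hμ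
      have h0 : ψ y = 0 := LinearMap.mem_ker.mp hy
      rw [hψ, Submodule.mkQ_apply, Submodule.Quotient.mk_eq_zero] at h0
      exact h0
  have hrn := LinearMap.finrank_range_add_finrank_ker ψ
  omega

/-- The split hypothesis for the `C`-slot: every obligation of a captured `W` is `3·Sym(C) + G` with `3·Sym(C) ∈ L3 U₁₂ U₁₂ U₁₂`
and `G ∈ prolong (U₀₁ ⊔ U₀₂ ⊔ U₁₂)`; likewise for the `B`- and `A`-slots. [folklore] -/
theorem split_mod_equalSpans (U01 U02 U12 W : Submodule ℂ (Fin 5 → Fin 5 → ℂ))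
    (h01 : ∀ x ∈ U01, ∀ p q : Fin 5, x p q = x q p) (h02 : ∀ x ∈ U02, ∀ p q : Fin 5, x p q = x q p)
    (h12 : ∀ x ∈ U12, ∀ p q : Fin 5, x p q = x q p)
    (hWc : ∀ μ ∈ W, contractZ μ ∈ L3 U01 U02 U12) :
    (∀ μ ∈ W, ∃ G ∈ prolong (U01 ⊔ U02 ⊔ U12), contractZ μ - G ∈ L3 U12 U12 U12) ∧
    (∀ μ ∈ W, ∃ G ∈ prolong (U01 ⊔ U02 ⊔ U12), contractZ μ - G ∈ L3 U02 U02 U02) ∧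
    (∀ μ ∈ W, ∃ G ∈ prolong (U01 ⊔ U02 ⊔ U12), contractZ μ - G ∈ L3 U01 U01 U01) := by
  have key : ∀ μ ∈ W, ∃ A B C : Fin 5 → Fin 5 → Fin 5 → ℂ, (∀ a, A a ∈ U01) ∧ (∀ a, B a ∈ U02) ∧ (∀ a, C a ∈ U12) ∧
      (contractZ μ - fun p q r => C r p q + C q p r + C p q r) ∈ prolong (U01 ⊔ U02 ⊔ U12) ∧
      (contractZ μ - fun p q r => B r p q + B q p r + B p q r) ∈ prolong (U01 ⊔ U02 ⊔ U12) ∧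
      (contractZ μ - fun p q r => A r p q + A q p r + A p q r) ∈ prolong (U01 ⊔ U02 ⊔ U12) := by
    intro μ hμ
    obtain ⟨A, B, C, hA, hB, hC, hT⟩ := L3_finite_form U01 U02 U12 (hWc μ hμ)
    have h := sub_symPlaced_mem_prolong U01 U02 U12 A B C (contractZ μ) hA hB hC
      (fun r p q => h01 _ (hA r) p q) (fun r p q => h02 _ (hB r) p q) (fun r p q => h12 _ (hC r) p q) hT
      (fun p q r => contractZ_swap12 μ p q r) (fun p q r => contractZ_swap23 μ p q r)
    exact ⟨A, B, C, hA, hB, hC, h.1, h.2.1, h.2.2⟩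
  refine ⟨fun μ hμ => ?_, fun μ hμ => ?_, fun μ hμ => ?_⟩
  · obtain ⟨A, B, C, -, -, hC, h, -, -⟩ := key μ hμ
    refine ⟨_, h, ?_⟩
    rw [sub_sub_cancel]
    exact symPlaced_mem_L3 U12 C hC
  · obtain ⟨A, B, C, -, hB, -, -, h, -⟩ := key μ hμ
    refine ⟨_, h, ?_⟩
    rw [sub_sub_cancel]
    exact symPlaced_mem_L3 U02 B hB
  · obtain ⟨A, B, C, hA, -, -, -, -, h⟩ := key μ hμ
    refine ⟨_, h, ?_⟩
    rw [sub_sub_cancel]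
    exact symPlaced_mem_L3 U01 A hA

/-- ★★ **`finrank W ≤ 3·finrank U₁₂ + finrank (prolong (U₀₁ ⊔ U₀₂ ⊔ U₁₂))`** for every captured space of symmetric zero-diagonal
leaf matrices (all three spans symmetric, any dimensions, any position). [folklore] -/
theorem finrank_le_three_mul_add_prolong_12 (U01 U02 U12 W : Submodule ℂ (Fin 5 → Fin 5 → ℂ))
    (h01 : ∀ x ∈ U01, ∀ p q : Fin 5, x p q = x q p) (h02 : ∀ x ∈ U02, ∀ p q : Fin 5, x p q = x q p)
    (h12 : ∀ x ∈ U12, ∀ p q : Fin 5, x p q = x q p)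
    (hWs : ∀ μ ∈ W, ∀ s t : Fin 5, μ s t = μ t s) (hWd : ∀ μ ∈ W, ∀ s : Fin 5, μ s s = 0)
    (hWc : ∀ μ ∈ W, contractZ μ ∈ L3 U01 U02 U12) :
    Module.finrank ℂ W ≤ 3 * Module.finrank ℂ U12 + Module.finrank ℂ (prolong (U01 ⊔ U02 ⊔ U12)) :=
  finrank_le_of_split_mod W _ _ _ (split_mod_equalSpans U01 U02 U12 W h01 h02 h12 hWc).1
    (fun W' hW' hW'c => finrank_le_three_mul_of_equalSpans U12 W' h12
      (fun μ hμ => hWs μ (hW' hμ)) (fun μ hμ => hWd μ (hW' hμ)) hW'c)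

/-- ★★ **`finrank W ≤ 3·finrank U₀₂ + finrank (prolong (U₀₁ ⊔ U₀₂ ⊔ U₁₂))`.** [folklore] -/
theorem finrank_le_three_mul_add_prolong_02 (U01 U02 U12 W : Submodule ℂ (Fin 5 → Fin 5 → ℂ))
    (h01 : ∀ x ∈ U01, ∀ p q : Fin 5, x p q = x q p) (h02 : ∀ x ∈ U02, ∀ p q : Fin 5, x p q = x q p)
    (h12 : ∀ x ∈ U12, ∀ p q : Fin 5, x p q = x q p)
    (hWs : ∀ μ ∈ W, ∀ s t : Fin 5, μ s t = μ t s) (hWd : ∀ μ ∈ W, ∀ s : Fin 5, μ s s = 0)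
    (hWc : ∀ μ ∈ W, contractZ μ ∈ L3 U01 U02 U12) :
    Module.finrank ℂ W ≤ 3 * Module.finrank ℂ U02 + Module.finrank ℂ (prolong (U01 ⊔ U02 ⊔ U12)) :=
  finrank_le_of_split_mod W _ _ _ (split_mod_equalSpans U01 U02 U12 W h01 h02 h12 hWc).2.1
    (fun W' hW' hW'c => finrank_le_three_mul_of_equalSpans U02 W' h02
      (fun μ hμ => hWs μ (hW' hμ)) (fun μ hμ => hWd μ (hW' hμ)) hW'c)

/-- ★★ **`finrank W ≤ 3·finrank U₀₁ + finrank (prolong (U₀₁ ⊔ U₀₂ ⊔ U₁₂))`.** [folklore] -/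
theorem finrank_le_three_mul_add_prolong_01 (U01 U02 U12 W : Submodule ℂ (Fin 5 → Fin 5 → ℂ))
    (h01 : ∀ x ∈ U01, ∀ p q : Fin 5, x p q = x q p) (h02 : ∀ x ∈ U02, ∀ p q : Fin 5, x p q = x q p)
    (h12 : ∀ x ∈ U12, ∀ p q : Fin 5, x p q = x q p)
    (hWs : ∀ μ ∈ W, ∀ s t : Fin 5, μ s t = μ t s) (hWd : ∀ μ ∈ W, ∀ s : Fin 5, μ s s = 0)
    (hWc : ∀ μ ∈ W, contractZ μ ∈ L3 U01 U02 U12) :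
    Module.finrank ℂ W ≤ 3 * Module.finrank ℂ U01 + Module.finrank ℂ (prolong (U01 ⊔ U02 ⊔ U12)) :=
  finrank_le_of_split_mod W _ _ _ (split_mod_equalSpans U01 U02 U12 W h01 h02 h12 hWc).2.2
    (fun W' hW' hW'c => finrank_le_three_mul_of_equalSpans U01 W' h01
      (fun μ hμ => hWs μ (hW' hμ)) (fun μ hμ => hWd μ (hW' hμ)) hW'c)

/-- ★ **`(SC)` UP TO THE JOINT PROLONGATION**: `finrank W ≤ finrank U₀₁ + finrank U₀₂ + finrank U₁₂ + finrank (prolong (U₀₁ ⊔ U₀₂ ⊔ U₁₂))`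
(average of the three slot bounds). [folklore] -/
theorem finrank_le_sum_add_prolong (U01 U02 U12 W : Submodule ℂ (Fin 5 → Fin 5 → ℂ))
    (h01 : ∀ x ∈ U01, ∀ p q : Fin 5, x p q = x q p) (h02 : ∀ x ∈ U02, ∀ p q : Fin 5, x p q = x q p)
    (h12 : ∀ x ∈ U12, ∀ p q : Fin 5, x p q = x q p)
    (hWs : ∀ μ ∈ W, ∀ s t : Fin 5, μ s t = μ t s) (hWd : ∀ μ ∈ W, ∀ s : Fin 5, μ s s = 0)
    (hWc : ∀ μ ∈ W, contractZ μ ∈ L3 U01 U02 U12) :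
    Module.finrank ℂ W ≤ Module.finrank ℂ U01 + Module.finrank ℂ U02 + Module.finrank ℂ U12
      + Module.finrank ℂ (prolong (U01 ⊔ U02 ⊔ U12)) := by
  have h1 := finrank_le_three_mul_add_prolong_01 U01 U02 U12 W h01 h02 h12 hWs hWd hWc
  have h2 := finrank_le_three_mul_add_prolong_02 U01 U02 U12 W h01 h02 h12 hWs hWd hWc
  have h3 := finrank_le_three_mul_add_prolong_12 U01 U02 U12 W h01 h02 h12 hWs hWd hWc
  omega

/-- ★★ **`CaptureIneqSym` ON THE LOCUS «JOINT SPAN WITHOUT PROLONGATION».**  If `prolong (U₀₁ ⊔ U₀₂ ⊔ U₁₂) = ⊥` (no nonzero fully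
symmetric 3-tensor has all its slices in the joint span), then every captured space `W` of symmetric zero-diagonal leaf matrices has
`finrank W ≤ finrank U₀₁ + finrank U₀₂ + finrank U₁₂` — all three spans symmetric, ANY dimensions, ANY position. [folklore] -/
theorem captureIneqSym_of_prolong_eq_bot (U01 U02 U12 W : Submodule ℂ (Fin 5 → Fin 5 → ℂ))
    (h01 : ∀ x ∈ U01, ∀ p q : Fin 5, x p q = x q p) (h02 : ∀ x ∈ U02, ∀ p q : Fin 5, x p q = x q p)
    (h12 : ∀ x ∈ U12, ∀ p q : Fin 5, x p q = x q p)
    (hP : prolong (U01 ⊔ U02 ⊔ U12) = ⊥)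
    (hWs : ∀ μ ∈ W, ∀ s t : Fin 5, μ s t = μ t s) (hWd : ∀ μ ∈ W, ∀ s : Fin 5, μ s s = 0)
    (hWc : ∀ μ ∈ W, contractZ μ ∈ L3 U01 U02 U12) :
    Module.finrank ℂ W ≤ Module.finrank ℂ U01 + Module.finrank ℂ U02 + Module.finrank ℂ U12 := by
  have h := finrank_le_sum_add_prolong U01 U02 U12 W h01 h02 h12 hWs hWd hWc
  have h0 : Module.finrank ℂ (prolong (U01 ⊔ U02 ⊔ U12)) = 0 := by rw [hP, finrank_bot]
  omega

/-- ★ **BOOKKEEPING FORM**: `(SC)` holds as soon as `3·finrank U_i + finrank (prolong (U₀₁ ⊔ U₀₂ ⊔ U₁₂)) ≤ Σ finrank U_j` for SOME slot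
`i` — to be fed with the tree's prolongation bounds (✓ `finrank_prolong_le_one/two/four/five`). [folklore] -/
theorem captureIneqSym_of_prolong_le (U01 U02 U12 W : Submodule ℂ (Fin 5 → Fin 5 → ℂ))
    (h01 : ∀ x ∈ U01, ∀ p q : Fin 5, x p q = x q p) (h02 : ∀ x ∈ U02, ∀ p q : Fin 5, x p q = x q p)
    (h12 : ∀ x ∈ U12, ∀ p q : Fin 5, x p q = x q p)
    (hP : 3 * Module.finrank ℂ U01 + Module.finrank ℂ (prolong (U01 ⊔ U02 ⊔ U12))
        ≤ Module.finrank ℂ U01 + Module.finrank ℂ U02 + Module.finrank ℂ U12 ∨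
      3 * Module.finrank ℂ U02 + Module.finrank ℂ (prolong (U01 ⊔ U02 ⊔ U12))
        ≤ Module.finrank ℂ U01 + Module.finrank ℂ U02 + Module.finrank ℂ U12 ∨
      3 * Module.finrank ℂ U12 + Module.finrank ℂ (prolong (U01 ⊔ U02 ⊔ U12))
        ≤ Module.finrank ℂ U01 + Module.finrank ℂ U02 + Module.finrank ℂ U12)
    (hWs : ∀ μ ∈ W, ∀ s t : Fin 5, μ s t = μ t s) (hWd : ∀ μ ∈ W, ∀ s : Fin 5, μ s s = 0)
    (hWc : ∀ μ ∈ W, contractZ μ ∈ L3 U01 U02 U12) :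
    Module.finrank ℂ W ≤ Module.finrank ℂ U01 + Module.finrank ℂ U02 + Module.finrank ℂ U12 := by
  have h1 := finrank_le_three_mul_add_prolong_01 U01 U02 U12 W h01 h02 h12 hWs hWd hWc
  have h2 := finrank_le_three_mul_add_prolong_02 U01 U02 U12 W h01 h02 h12 hWs hWd hWc
  have h3 := finrank_le_three_mul_add_prolong_12 U01 U02 U12 W h01 h02 h12 hWs hWd hWc
  omega

end LaplaceFiveSeparatedCapture

end Summit.ValiantsHypothesis.ValiantsHypothesis.Theorems.RigidityForcesSymmetryRankRigidMinimalRepr
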